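import Summits.AtomisticToContinuum.BoseEinsteinCondensation.Theorems.BECCutLineWeakDisorderAcrossCutComposeIR
import Summits.AtomisticToContinuum.BoseEinsteinCondensation.Theorems.BECCutLineWeakDisorderAcrossCutBlockSingularFree
import Summits.AtomisticToContinuum.BoseEinsteinCondensation.Theorems.BECCutLineWeakDisorderTwoReplicaTransienceBoundDecoupling
import Summits.AtomisticToContinuum.BoseEinsteinCondensation.Theorems.BECCutLineWeakDisorderLandscapeBoundSiblingCompose
import Summits.AtomisticToContinuum.BoseEinsteinCondensation.Theorems.TwoReplicaTransienceBound.Negative.ConstantAtLeastOne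
import HarnessLib

/-!
# Crux `TwoReplicaTransienceBound` (stmt-AtomisticToContinuum-9687), line `across-cut-thinning` v3:
# the sorry-free COMPOSITION (`stub_acrossCutCompose`)

Support file (`--supports stmt-AtomisticToContinuum-9687`, lead c6; does not close the item). The seven
registered stub statements of `Theorems/BECCutLineWeakDisorderAcrossCutDefs.lean` imply the crux
`Theses.BECCutLineWeakDisorder.TwoReplicaTransienceBound` BY NAME (`TwoReplicaTransienceBound_of`).
Kinetic constant `κ = min κ₀ (κ_w/A)` from the UV stub `KineticScaleFlatnessBeyond` and the LANDED
mean-free window `TracerDecoupling.stub_meanFreeWindow` (constant `20` for `T ≤ κ_w/ρ`); for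
`T ≥ Aκ/ρ` the chain `crux ≤ (E_μ r̄²)^{1/2}(E_μ R_IR²)^{1/2}`, `L³E_μR_IR² ≤ (∫s²r̄²)^{1/2}(∫s²R_IR⁶)^{1/2}`,
`∫s²r̄² ≤ L³(1+E_μr̄²)`, `∫s²R_IR⁶ ≤ C₂(cC₁)⁶∫s²` (IR chain `irChain_tail_cancelled` of
`…AcrossCutComposeIR.lean` from the tail module, the mean-profile module and the annealed block
two-replica bound at every kinetic block) — the block bound supplied BY CASES on boundedness of `v` ON
`[0,∞)`: bounded ⇒ the tilt device (`stub_blockOfCovariance`, fed by `stub_tiltFTC`) applied to the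
covariance item `stub_crossCovarianceBdd` for the bounded modification `v·𝟙_{[0,∞)}` (FK-identical:
`BlockSingularFree.*_congr_nonneg`), `c = e^{κ₀}`; unbounded ⇒ `stub_blockTwoReplicaUnbounded`.
Constant `max ((C_U+1)((1+C_U)C₂(cC₁)⁶ + 2)) 20 ≥ 1`. Body = the planner's v1 checked-skeleton
composition verbatim; quantifier prefix (time split + cases) = lead c6.
-/

noncomputable section

open MeasureTheory Filter Set Finset
open scoped ENNReal NNReal Topology BigOperators

namespace Summit.AtomisticToContinuum.BoseEinsteinCondensation.Cruxes.TwoReplicaTransienceBound.AcrossCutThinning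

open Literature.MathematicalPhysics.QuantumManyBody.BoseGas
open Summit.AtomisticToContinuum.BoseEinsteinCondensation.Theses.BECCutLineWeakDisorder
open Summit.AtomisticToContinuum.BoseEinsteinCondensation.Cruxes.TwoReplicaTransienceBound.TracerDecoupling
open Summit.AtomisticToContinuum.BoseEinsteinCondensation.Cruxes.TwoReplicaTransienceBound.TaggedShiftLogHarnack
  (kineticDepth KineticScaleFlatnessBeyond)
open Summit.AtomisticToContinuum.BoseEinsteinCondensation.Cruxes.LandscapeBound.SiblingTelescopingChaining

variable {n : ℕ}

namespace Goal

/-- Registered bookkeeping stub `stub_acrossCutCompose`: the seven stub statements imply the crux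
`TwoReplicaTransienceBound` BY NAME (proved below as `stub_acrossCutCompose`). -/
abbrev stub_acrossCutCompose : Prop :=
  stub_tiltFTC → stub_blockOfCovariance → stub_crossCovarianceBdd → stub_blockTwoReplicaUnbounded →
    stub_meanProfileFlat → stub_participationTail → stub_kineticScaleFlatnessBeyond →
      Summit.AtomisticToContinuum.BoseEinsteinCondensation.Theses.BECCutLineWeakDisorder.TwoReplicaTransienceBound

end Goal

/-! ## The composition: `TwoReplicaTransienceBound` BY NAME from the seven stubs (sorry-free) -/

/-- **The crux from the registered stubs (v3)**: time split at the kinetic time `Aκ/ρ` (landed window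
below), then the chain of the module docstring with the block two-replica bound by cases on boundedness
of `v` on `[0,∞)`; every degenerate case is handled by the junk-value conventions. -/
theorem TwoReplicaTransienceBound_of :
    Goal.stub_tiltFTC → Goal.stub_blockOfCovariance → Goal.stub_crossCovarianceBdd →
      Goal.stub_blockTwoReplicaUnbounded → Goal.stub_meanProfileFlat → Goal.stub_participationTail →
        Goal.stub_kineticScaleFlatnessBeyond → TwoReplicaTransienceBound := by
  intro hFTC hBoC hCov hUnb hMean hTail hUV v hv
  have hvm : Measurable v := hv.1
  obtain ⟨κw, hκw, ρw, hρw, HW⟩ := TracerDecoupling.stub_meanFreeWindow v hv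
  obtain ⟨κ₀, hκ₀, A, hA, HU⟩ := hUV v hv
  have hApos : 0 < A := one_pos.trans_le hA
  set κ : ℝ := min κ₀ (κw / A) with hκdef
  have hκ : 0 < κ := lt_min hκ₀ (div_pos hκw hApos)
  have hκ₀' : κ ≤ κ₀ := min_le_left _ _
  have hκw' : A * κ ≤ κw := by
    have h1 : κ ≤ κw / A := min_le_right _ _
    rw [le_div_iff₀ hApos] at h1
    linarith [mul_comm κ A]
  obtain ⟨ρ₁, hρ₁, H1⟩ := HU κ hκ hκ₀'
  obtain ⟨ρ₃, hρ₃, H3⟩ := hMean v hv κ hκ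
  obtain ⟨ρ₄, hρ₄, H4⟩ := hTail v hv κ hκ
  have hIR : ∃ ρ₂ : ℝ, 0 < ρ₂ ∧ ∀ ρ : ℝ, 0 < ρ → ρ < ρ₂ → ∃ cIR : ℝ, 0 < cIR ∧
      ∀ᶠ n : ℕ in atTop, ∀ T : ℝ, 1 ≤ T →
        ∀ i : Fin 3 → Fin (2 ^ kineticDepth κ ρ (sideLength ρ (n + 1))),
          bathTwo v (sideLength ρ (n + 1)) T n *
              ∫⁻ Y : Config n, blockAmp v (sideLength ρ (n + 1)) T
                (kineticDepth κ ρ (sideLength ρ (n + 1))) i Y ^ 2 ≤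
            ENNReal.ofReal cIR *
              meanAmp v (sideLength ρ (n + 1)) T (kineticDepth κ ρ (sideLength ρ (n + 1))) i n ^ 2 := by
    by_cases hbdd : ∃ C : ℝ≥0, ∀ r, 0 ≤ r → v r ≤ C
    · -- bounded on `[0,∞)`: the tilt device, run on the bounded modification `ṽ = v · 𝟙_{[0,∞)}`
      obtain ⟨C, hC⟩ := hbdd
      obtain ⟨-, R₀, hR₀⟩ := hv
      set w : ℝ → ℝ≥0∞ := fun r => if 0 ≤ r then v r else 0 with hwdef
      have hwa : IsRepulsiveFiniteRange w :=
        ⟨Measurable.ite measurableSet_Ici hvm measurable_const, R₀, fun r hr => by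
          simp only [hwdef]; split_ifs <;> simp [hR₀ r hr]⟩
      have hwb : ∃ C : ℝ≥0, ∀ r, w r ≤ C :=
        ⟨C, fun r => by simp only [hwdef]; split_ifs with h <;> simp [hC r, h]⟩
      have hag : ∀ r, 0 ≤ r → v r = w r := fun r hr => by simp [hwdef, hr]
      obtain ⟨ρ₂, hρ₂, H2⟩ := hCov w hwa hwb
      refine ⟨ρ₂, hρ₂, fun ρ hρ hρ2 => ?_⟩
      obtain ⟨κc, hκc, ev⟩ := H2 ρ hρ hρ2
      refine ⟨Real.exp κc, Real.exp_pos _, ?_⟩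
      filter_upwards [ev] with n hC T hT i
      have hLpos : 0 < sideLength ρ (n + 1) :=
        Real.rpow_pos_of_pos (div_pos (Nat.cast_pos.mpr n.succ_pos) hρ) _
      have h := hBoC hFTC n w hwa.1 hwb _ T hLpos (zero_le_one.trans hT) κc hκc
        (fun s t hs ht x x' ω₀ ω₀' => hC T hT s t hs ht x x' ω₀ ω₀') _ i
      rw [bathTwo_congr_nonneg hag, meanAmp_congr_nonneg hag]
      simp_rw [blockAmp_congr_nonneg hag]
      exact h
    · -- unbounded on `[0,∞)`: the block two-replica bound is the conjecture input itself
      obtain ⟨ρ₂, hρ₂, H2⟩ := hUnb v hv hbdd κ hκ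
      exact ⟨ρ₂, hρ₂, fun ρ hρ hρ2 => H2 ρ hρ hρ2⟩
  obtain ⟨ρ₂, hρ₂, H2⟩ := hIR
  refine ⟨min (min (min ρ₁ ρ₂) (min ρ₃ ρ₄)) ρw,
    lt_min (lt_min (lt_min hρ₁ hρ₂) (lt_min hρ₃ hρ₄)) hρw, fun ρ hρ hρlt => ?_⟩
  have hρ1 : ρ < ρ₁ :=
    hρlt.trans_le ((min_le_left _ _).trans ((min_le_left _ _).trans (min_le_left _ _)))
  have hρ2 : ρ < ρ₂ :=
    hρlt.trans_le ((min_le_left _ _).trans ((min_le_left _ _).trans (min_le_right _ _)))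
  have hρ3 : ρ < ρ₃ :=
    hρlt.trans_le ((min_le_left _ _).trans ((min_le_right _ _).trans (min_le_left _ _)))
  have hρ4 : ρ < ρ₄ :=
    hρlt.trans_le ((min_le_left _ _).trans ((min_le_right _ _).trans (min_le_right _ _)))
  have hρw' : ρ < ρw := hρlt.trans_le (min_le_right _ _)
  obtain ⟨CU, hCU, ev1⟩ := H1 ρ hρ hρ1
  obtain ⟨cIR, hcIR, ev2⟩ := H2 ρ hρ hρ2
  obtain ⟨C₁, hC₁, ev3⟩ := H3 ρ hρ hρ3
  obtain ⟨C₂, hC₂, ev4⟩ := H4 ρ hρ hρ4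
  have evW := HW ρ hρ hρw'
  set C₆ : ℝ := C₂ * (cIR * C₁) ^ 6 with hC₆def
  have hC₆ : 0 ≤ C₆ := by positivity
  refine ⟨max ((CU + 1) * ((1 + CU) * C₆ + 2)) 20, lt_max_of_lt_right (by norm_num), ?_⟩
  filter_upwards [ev1, ev2, ev3, ev4, evW] with n hU hTRall hM hP hW T hT
  rcases le_total T (A * κ / ρ) with hTle | hTge
  · -- inside the kinetic window: the landed crux bound (constant `20`)
    have hTw : T ≤ κw / ρ := hTle.trans (div_le_div_of_nonneg_right hκw' hρ.le)
    exact (hW T (zero_le_one.trans hT) hTw).trans (ENNReal.ofReal_le_ofReal (le_max_right _ _))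
  refine le_trans ?_ (ENNReal.ofReal_le_ofReal (le_max_left _ 20))
  have hT0 : 0 ≤ T := zero_le_one.trans hT
  set L : ℝ := sideLength ρ (n + 1) with hLdef
  have hLpos : 0 < L := Real.rpow_pos_of_pos (div_pos (Nat.cast_pos.mpr n.succ_pos) hρ) _
  set K : ℕ := kineticDepth κ ρ L with hKdef
  set Ψ : Config (n + 1) → ℝ := fkWitness (N := n + 1) v L T (fun _ => (1 : ℝ≥0∞)) with hΨdef
  set 𝒩 : ℝ≥0∞ := fkNormSq (N := n + 1) v L T (fun _ => (1 : ℝ≥0∞)) with h𝒩def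
  have hΨm : Measurable Ψ := measurable_fkWitness hvm L T measurable_const
  set L3 : ℝ≥0∞ := ENNReal.ofReal (L ^ 3) with hL3def
  have hL30 : L3 ≠ 0 := by rw [hL3def]; exact (ENNReal.ofReal_pos.2 (by positivity)).ne'
  have hL3t : L3 ≠ ⊤ := ENNReal.ofReal_ne_top
  -- the goal, in the slice vocabulary
  change ∫⁻ Y : Config n, L3 * (∫⁻ x, slice Ψ Y x ^ 2) ^ 2 / (∫⁻ x, slice Ψ Y x) ^ 2 ≤
    ENNReal.ofReal ((CU + 1) * ((1 + CU) * C₆ + 2))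
  -- degenerate normalisation: the witness vanishes
  by_cases hdeg : 𝒩 = 0 ∨ 𝒩 = ⊤
  · have hΨ0 : ∀ X, Ψ X = 0 := fkWitness_eq_zero_of_normSq hdeg
    have hsl : ∀ Y x, slice Ψ Y x = 0 := fun Y x => by
      show ((‖Ψ (Matrix.vecCons x Y)‖₊ : ℝ≥0∞)) = 0
      simp [hΨ0]
    simp [hsl]
  simp only [not_or] at hdeg
  obtain ⟨h𝒩0, h𝒩t⟩ := hdeg
  /- ### the witness as a multiple of the partition function -/
  set cR : ℝ := (Real.sqrt 𝒩.toReal)⁻¹ with hcRdef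
  have htR : 0 < 𝒩.toReal := ENNReal.toReal_pos h𝒩0 h𝒩t
  have hcRpos : 0 < cR := inv_pos.2 (Real.sqrt_pos.2 htR)
  set Cc : ℝ≥0∞ := ENNReal.ofReal cR with hCcdef
  have hCc0 : Cc ≠ 0 := (ENNReal.ofReal_pos.2 hcRpos).ne'
  have hCct : Cc ≠ ⊤ := ENNReal.ofReal_ne_top
  have hslice : ∀ Y x, slice Ψ Y x = Cc * partSlice v L T Y x := by
    intro Y x
    show ((‖Ψ (Matrix.vecCons x Y)‖₊ : ℝ≥0∞)) = Cc * fkPartition v L T (Matrix.vecCons x Y)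
    rw [coe_nnnorm_fkWitness, fkWitness_one_eq, ENNReal.ofReal_mul hcRpos.le,
      ENNReal.ofReal_toReal (fkPartition_ne_top v L T _)]
  have hsliceF : ∀ Y, slice Ψ Y = fun x => Cc * partSlice v L T Y x := fun Y => funext (hslice Y)
  /- ### notation -/
  set m : Config n → ℝ≥0∞ := fun Y => ∫⁻ x, slice Ψ Y x ^ 2 with hmdef
  set s : Config n → ℝ≥0∞ := fun Y => ∫⁻ x, slice Ψ Y x with hsdef
  set rbar : Config n → ℝ≥0∞ := fun Y => uvParticipation (slice Ψ Y) L K with hrbardef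
  set RIR : Config n → ℝ≥0∞ := fun Y => acrossPR (slice Ψ Y) L K with hRIRdef
  set sΦ : Config n → ℝ≥0∞ := fun Y => ∫⁻ x, partSlice v L T Y x with hsΦdef
  set RΦ : Config n → ℝ≥0∞ := fun Y => acrossPR (partSlice v L T Y) L K with hRΦdef
  have hm_meas : Measurable m := measurable_lintegral_slice_sq hΨm
  have hs_meas : Measurable s := measurable_lintegral_slice hΨm
  have hrbar_meas : Measurable rbar := measurable_uvParticipation hΨm L K
  have hRIR_meas : Measurable RIR := by
    rw [hRIRdef]
    unfold acrossPR
    exact (measurable_const.mul (measurable_levelSq hΨm L K)).div (hs_meas.pow_const 2)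
  have hsΦ_meas : Measurable sΦ := measurable_lintegral_partSlice hvm L T
  have hRΦ_meas : Measurable RΦ := measurable_acrossPR_partSlice hvm L T K
  have hZ_meas : Measurable fun Y : Config n => fkPartition v L T Y := measurable_fkPartition_bath hvm L T
  have hm1 : ∫⁻ Y, m Y = 1 := lintegral_lintegral_slice_sq hvm L T h𝒩0 h𝒩t
  have h0Y : ∀ (Y : Config n) (x : Space), x ∉ box L → slice Ψ Y x = 0 := fun Y x hx =>
    slice_fkWitness_eq_zero v hT0 _ Y hx
  have hsΦt : ∀ Y, sΦ Y ≠ ⊤ := fun Y =>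
    ne_top_of_le_ne_top (ENNReal.pow_ne_top ENNReal.ofReal_ne_top) (lintegral_partSlice_le hT0 Y)
  have hs_eq : ∀ Y, s Y = Cc * sΦ Y := fun Y => by
    simp only [hsdef, hsΦdef, hsliceF Y]
    exact lintegral_const_mul' _ _ hCct
  have hst : ∀ Y, s Y ≠ ⊤ := fun Y => by rw [hs_eq Y]; exact ENNReal.mul_ne_top hCct (hsΦt Y)
  have hRIR_eq : ∀ Y, RIR Y = RΦ Y := fun Y => by
    simp only [hRIRdef, hRΦdef, hsliceF Y]
    exact acrossPR_const_mul hCc0 hCct _ L K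
  /- ### pointwise inequalities for the slice `g = |Ψ_T(·, Y)|` -/
  have hP3 : ∀ Y, s Y ^ 2 ≤ L3 * m Y := fun Y =>
    sq_lintegral_le_vol_mul (measurable_slice hΨm Y) hLpos.le (h0Y Y)
  have hP2 : ∀ Y, s Y ^ 2 * rbar Y ≤ L3 * m Y := fun Y => sq_mul_uv_le hLpos (h0Y Y) K
  have hP1 : ∀ Y, L3 * m Y ≤ s Y ^ 2 * rbar Y * RIR Y := fun Y =>
    vol_mul_le_sq_mul_uv_mul_across (measurable_slice hΨm Y) hLpos (h0Y Y) (hst Y) K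
  /- ### step 1: the integrand is at most `m · r̄ · R_IR` -/
  have hpt : ∀ Y, L3 * m Y ^ 2 / s Y ^ 2 ≤ m Y * (rbar Y * RIR Y) := by
    intro Y
    rcases eq_or_ne (s Y) 0 with hs0 | hs0
    · have hae : slice Ψ Y =ᵐ[volume] 0 := (lintegral_eq_zero_iff (measurable_slice hΨm Y)).1 hs0
      have hm0 : m Y = 0 := by
        show ∫⁻ x, slice Ψ Y x ^ 2 = 0
        rw [lintegral_eq_zero_iff ((measurable_slice hΨm Y).pow_const 2)]
        filter_upwards [hae] with x hx
        simp [hx]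
      simp [hm0]
    have hs2 : s Y ^ 2 ≠ 0 := pow_ne_zero 2 hs0
    have hs2t : s Y ^ 2 ≠ ⊤ := ENNReal.pow_ne_top (hst Y)
    calc L3 * m Y ^ 2 / s Y ^ 2 = (L3 * m Y) * m Y / s Y ^ 2 := by rw [sq, mul_assoc]
      _ ≤ (s Y ^ 2 * rbar Y * RIR Y) * m Y / s Y ^ 2 :=
          ENNReal.div_le_div_right (mul_le_mul' (hP1 Y) le_rfl) _
      _ = s Y ^ 2 * (rbar Y * RIR Y * m Y) / s Y ^ 2 := by ring_nf
      _ = rbar Y * RIR Y * m Y := by rw [mul_comm, ENNReal.mul_div_cancel_right hs2 hs2t]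
      _ = m Y * (rbar Y * RIR Y) := by ring
  set μ : Measure (Config n) := volume.withDensity m with hμdef
  haveI : IsProbabilityMeasure μ :=
    ⟨by rw [hμdef, withDensity_apply _ MeasurableSet.univ, Measure.restrict_univ, hm1]⟩
  have hCS : ∫⁻ Y, (rbar * RIR) Y ∂μ ≤
      (∫⁻ Y, rbar Y ^ (2 : ℝ) ∂μ) ^ (1 / (2 : ℝ)) * (∫⁻ Y, RIR Y ^ (2 : ℝ) ∂μ) ^ (1 / (2 : ℝ)) :=
    ENNReal.lintegral_mul_le_Lp_mul_Lq μ Real.HolderConjugate.two_two hrbar_meas.aemeasurable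
      hRIR_meas.aemeasurable
  /- ### step 3: the UV factor -/
  have hUVfac : ∫⁻ Y, rbar Y ^ (2 : ℝ) ∂μ ≤ ENNReal.ofReal CU := by
    simp only [ENNReal.rpow_two]
    rw [hμdef, lintegral_withDensity_eq_lintegral_mul _ hm_meas (hrbar_meas.pow_const 2)]
    exact hU T hTge
  have hUV2 : ∫⁻ Y, m Y * rbar Y ^ 2 ≤ ENNReal.ofReal CU := hU T hTge
  have hmr2 : Measurable fun Y => m Y * rbar Y ^ 2 := hm_meas.mul (hrbar_meas.pow_const 2)
  have hUV1 : ∫⁻ Y, m Y * rbar Y ≤ 1 + ENNReal.ofReal CU := by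
    have hadd : ∫⁻ Y, m Y * rbar Y ≤ ∫⁻ Y, (m Y + m Y * rbar Y ^ 2) :=
      lintegral_mono fun Y => by
        calc m Y * rbar Y ≤ m Y * (1 + rbar Y ^ 2) := mul_le_mul' le_rfl (le_one_add_pow _ two_ne_zero)
          _ = m Y + m Y * rbar Y ^ 2 := by rw [mul_add, mul_one]
    refine hadd.trans ?_
    rw [lintegral_add_left hm_meas]
    exact add_le_add hm1.le hUV2
  /- ### step 4: the IR chain in the partition-function normalisation -/
  set cexp : ℝ≥0∞ := ENNReal.ofReal cIR with hcexpdef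
  have hTR : ∀ i : Fin 3 → Fin (2 ^ K),
      bathTwo v L T n * ∫⁻ Y : Config n, blockAmp v L T K i Y ^ 2 ≤ cexp * meanAmp v L T K i n ^ 2 :=
    fun i => hTRall T hT i
  have h𝒩eq : 𝒩 = ∫⁻ Y : Config n, ∫⁻ x, partSlice v L T Y x ^ 2 := by
    rw [h𝒩def, fkNormSq_def]
    exact lintegral_config_succ ((measurable_fkSemigroup hvm L T measurable_const).pow_const 2)
  have hbath0 : bathTwo v L T n ≠ 0 := by
    intro h0
    have hae : (fun Y : Config n => fkPartition v L T Y ^ 2) =ᵐ[volume] 0 :=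
      (lintegral_eq_zero_iff (hZ_meas.pow_const 2)).1 h0
    apply h𝒩0
    rw [h𝒩eq, lintegral_eq_zero_iff (measurable_lintegral_partSlice_sq hvm L T)]
    filter_upwards [hae] with Y hY
    have hZ0 : fkPartition v L T Y = 0 := by simpa using hY
    show ∫⁻ x, partSlice v L T Y x ^ 2 = 0
    refine (lintegral_eq_zero_iff ((measurable_partSlice hvm L T Y).pow_const 2)).2 ?_
    refine Eventually.of_forall fun x => ?_
    have : partSlice v L T Y x = 0 :=
      le_antisymm ((partSlice_le_fkPartition hvm L T Y x).trans hZ0.le) bot_le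
    simp [this]
  have hIs0 : ∫⁻ Y : Config n, sΦ Y ^ 2 ≠ 0 := by
    intro h0
    have hae : (fun Y : Config n => sΦ Y ^ 2) =ᵐ[volume] 0 :=
      (lintegral_eq_zero_iff (hsΦ_meas.pow_const 2)).1 h0
    apply h𝒩0
    rw [h𝒩eq, lintegral_eq_zero_iff (measurable_lintegral_partSlice_sq hvm L T)]
    filter_upwards [hae] with Y hY
    have hs0 : sΦ Y = 0 := by simpa using hY
    have hae' : partSlice v L T Y =ᵐ[volume] 0 :=
      (lintegral_eq_zero_iff (measurable_partSlice hvm L T Y)).1 hs0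
    show ∫⁻ x, partSlice v L T Y x ^ 2 = 0
    rw [lintegral_eq_zero_iff ((measurable_partSlice hvm L T Y).pow_const 2)]
    filter_upwards [hae'] with x hx
    simp [hx]
  -- the IR chain in the partition-function normalisation, tail cancelled (bookkeeping file)
  have h4g : ∫⁻ Y : Config n, sΦ Y ^ 2 * RΦ Y ^ 6 ≤ ENNReal.ofReal C₆ * ∫⁻ Y : Config n, sΦ Y ^ 2 := by
    have hC₆eq : ENNReal.ofReal C₆ = ENNReal.ofReal C₂ * (cexp * ENNReal.ofReal C₁) ^ 6 := by
      rw [hC₆def, hcexpdef, ENNReal.ofReal_mul hC₂.le, ENNReal.ofReal_pow (by positivity),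
        ENNReal.ofReal_mul hcIR.le]
    rw [hC₆eq]
    exact irChain_tail_cancelled hvm hT0 K hTR (hM T hT) (hP T hT) hbath0 hIs0
  /- ### step 5: back to the witness normalisation: `∫ s² R_IR⁶ ≤ C₆ L³` -/
  have h5 : ∫⁻ Y, s Y ^ 2 * RIR Y ^ 6 ≤ ENNReal.ofReal C₆ * L3 := by
    have hs2int : ∫⁻ Y, s Y ^ 2 ≤ L3 := by
      calc ∫⁻ Y, s Y ^ 2 ≤ ∫⁻ Y, L3 * m Y := lintegral_mono hP3
        _ = L3 * ∫⁻ Y, m Y := lintegral_const_mul _ hm_meas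
        _ = L3 := by rw [hm1, mul_one]
    calc ∫⁻ Y, s Y ^ 2 * RIR Y ^ 6 = ∫⁻ Y, Cc ^ 2 * (sΦ Y ^ 2 * RΦ Y ^ 6) := by
          refine lintegral_congr fun Y => ?_
          rw [hs_eq Y, hRIR_eq Y]; ring
      _ = Cc ^ 2 * ∫⁻ Y, sΦ Y ^ 2 * RΦ Y ^ 6 :=
          lintegral_const_mul _ ((hsΦ_meas.pow_const 2).mul (hRΦ_meas.pow_const 6))
      _ ≤ Cc ^ 2 * (ENNReal.ofReal C₆ * ∫⁻ Y : Config n, sΦ Y ^ 2) := mul_le_mul' le_rfl h4g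
      _ = ENNReal.ofReal C₆ * ∫⁻ Y, Cc ^ 2 * sΦ Y ^ 2 := by
          rw [lintegral_const_mul _ (hsΦ_meas.pow_const 2)]; ring
      _ = ENNReal.ofReal C₆ * ∫⁻ Y, s Y ^ 2 := by
          congr 1
          exact lintegral_congr fun Y => by rw [hs_eq Y]; ring
      _ ≤ ENNReal.ofReal C₆ * L3 := mul_le_mul' le_rfl hs2int
  /- ### step 6: `∫ s² r̄² ≤ L³ (1 + C_U)` -/
  have h6 : ∫⁻ Y, s Y ^ 2 * rbar Y ^ 2 ≤ L3 * (1 + ENNReal.ofReal CU) := by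
    calc ∫⁻ Y, s Y ^ 2 * rbar Y ^ 2 = ∫⁻ Y, (s Y ^ 2 * rbar Y) * rbar Y := by
          refine lintegral_congr fun Y => ?_; ring
      _ ≤ ∫⁻ Y, (L3 * m Y) * rbar Y := lintegral_mono fun Y => mul_le_mul' (hP2 Y) le_rfl
      _ = L3 * ∫⁻ Y, m Y * rbar Y := by
          have hmr : Measurable fun Y => m Y * rbar Y := hm_meas.mul hrbar_meas
          rw [← lintegral_const_mul _ hmr]
          refine lintegral_congr fun Y => ?_; ring
      _ ≤ L3 * (1 + ENNReal.ofReal CU) := mul_le_mul' le_rfl hUV1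
  /- ### step 7: `L³ ∫ m R_IR² ≤ (∫ s² r̄²)^{1/2} (∫ s² R_IR⁶)^{1/2}`, hence `E_μ R_IR² ≤ D` -/
  have hIRfac : ∫⁻ Y, RIR Y ^ (2 : ℝ) ∂μ ≤ ENNReal.ofReal ((1 + CU) * C₆) + 1 := by
    simp only [ENNReal.rpow_two]
    rw [hμdef, lintegral_withDensity_eq_lintegral_mul _ hm_meas (hRIR_meas.pow_const 2)]
    -- pointwise `L³ m R² ≤ (s r̄) · (s R³)`
    have hptw : ∀ Y, L3 * (m Y * RIR Y ^ 2) ≤ (s Y * rbar Y) * (s Y * RIR Y ^ 3) := by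
      intro Y
      calc L3 * (m Y * RIR Y ^ 2) = (L3 * m Y) * RIR Y ^ 2 := by ring
        _ ≤ (s Y ^ 2 * rbar Y * RIR Y) * RIR Y ^ 2 := mul_le_mul' (hP1 Y) le_rfl
        _ = (s Y * rbar Y) * (s Y * RIR Y ^ 3) := by ring
    have hf_meas : Measurable fun Y => s Y * rbar Y := hs_meas.mul hrbar_meas
    have hg_meas : Measurable fun Y => s Y * RIR Y ^ 3 := hs_meas.mul (hRIR_meas.pow_const 3)
    have hCS3 := ENNReal.lintegral_mul_le_Lp_mul_Lq (volume : Measure (Config n))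
      Real.HolderConjugate.two_two hf_meas.aemeasurable hg_meas.aemeasurable
    have hmain : L3 * ∫⁻ Y, (m * fun Y => RIR Y ^ 2) Y ≤
        (L3 * (1 + ENNReal.ofReal CU)) ^ (1 / (2 : ℝ)) * (ENNReal.ofReal C₆ * L3) ^ (1 / (2 : ℝ)) := by
      calc L3 * ∫⁻ Y, (m * fun Y => RIR Y ^ 2) Y = ∫⁻ Y, L3 * (m Y * RIR Y ^ 2) := by
            rw [← lintegral_const_mul _ (hm_meas.mul (hRIR_meas.pow_const 2))]; rfl
        _ ≤ ∫⁻ Y, ((fun Y => s Y * rbar Y) * fun Y => s Y * RIR Y ^ 3) Y := lintegral_mono hptw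
        _ ≤ (∫⁻ Y, (s Y * rbar Y) ^ (2 : ℝ)) ^ (1 / (2 : ℝ)) *
              (∫⁻ Y, (s Y * RIR Y ^ 3) ^ (2 : ℝ)) ^ (1 / (2 : ℝ)) := hCS3
        _ = (∫⁻ Y, s Y ^ 2 * rbar Y ^ 2) ^ (1 / (2 : ℝ)) *
              (∫⁻ Y, s Y ^ 2 * RIR Y ^ 6) ^ (1 / (2 : ℝ)) := by
            simp only [ENNReal.rpow_two]
            congr 2
            · exact lintegral_congr fun Y => by ring
            · exact lintegral_congr fun Y => by ring
        _ ≤ (L3 * (1 + ENNReal.ofReal CU)) ^ (1 / (2 : ℝ)) * (ENNReal.ofReal C₆ * L3) ^ (1 / (2 : ℝ)) := by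
            gcongr
    -- `(L³ a)^{1/2} (b L³)^{1/2} = L³ (a b)^{1/2}`
    have hsplit : (L3 * (1 + ENNReal.ofReal CU)) ^ (1 / (2 : ℝ)) *
        (ENNReal.ofReal C₆ * L3) ^ (1 / (2 : ℝ)) =
        L3 * ((1 + ENNReal.ofReal CU) * ENNReal.ofReal C₆) ^ (1 / (2 : ℝ)) := by
      have hhalf : (0 : ℝ) ≤ 1 / 2 := by norm_num
      rw [← ENNReal.mul_rpow_of_nonneg _ _ hhalf,
        show L3 * (1 + ENNReal.ofReal CU) * (ENNReal.ofReal C₆ * L3) =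
          L3 ^ 2 * ((1 + ENNReal.ofReal CU) * ENNReal.ofReal C₆) by ring,
        ENNReal.mul_rpow_of_nonneg _ _ hhalf]
      congr 1
      rw [← ENNReal.rpow_natCast, ← ENNReal.rpow_mul]
      norm_num
    rw [hsplit] at hmain
    have hcancel : ∫⁻ Y, (m * fun Y => RIR Y ^ 2) Y ≤
        ((1 + ENNReal.ofReal CU) * ENNReal.ofReal C₆) ^ (1 / (2 : ℝ)) :=
      (ENNReal.mul_le_mul_iff_right hL30 hL3t).1 hmain
    calc ∫⁻ Y, m Y * RIR Y ^ 2 = ∫⁻ Y, (m * fun Y => RIR Y ^ 2) Y := rfl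
      _ ≤ ((1 + ENNReal.ofReal CU) * ENNReal.ofReal C₆) ^ (1 / (2 : ℝ)) := hcancel
      _ ≤ (1 + ENNReal.ofReal CU) * ENNReal.ofReal C₆ + 1 := rpow_half_le_add_one _
      _ = ENNReal.ofReal ((1 + CU) * C₆) + 1 := by
          have e1 : ENNReal.ofReal ((1 + CU) * C₆) = (1 + ENNReal.ofReal CU) * ENNReal.ofReal C₆ := by
            rw [ENNReal.ofReal_mul (by positivity), ENNReal.ofReal_add zero_le_one hCU.le,
              ENNReal.ofReal_one]
          rw [e1]
  /- ### assemble -/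
  calc ∫⁻ Y, L3 * (∫⁻ x, slice Ψ Y x ^ 2) ^ 2 / (∫⁻ x, slice Ψ Y x) ^ 2
      ≤ ∫⁻ Y, m Y * (rbar Y * RIR Y) := lintegral_mono hpt
    _ = ∫⁻ Y, (rbar * RIR) Y ∂μ := by
        rw [hμdef, lintegral_withDensity_eq_lintegral_mul _ hm_meas (hrbar_meas.mul hRIR_meas)]
        rfl
    _ ≤ (∫⁻ Y, rbar Y ^ (2 : ℝ) ∂μ) ^ (1 / (2 : ℝ)) * (∫⁻ Y, RIR Y ^ (2 : ℝ) ∂μ) ^ (1 / (2 : ℝ)) := hCS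
    _ ≤ (ENNReal.ofReal CU) ^ (1 / (2 : ℝ)) * (ENNReal.ofReal ((1 + CU) * C₆) + 1) ^ (1 / (2 : ℝ)) := by
        gcongr
    _ ≤ (ENNReal.ofReal CU + 1) * (ENNReal.ofReal ((1 + CU) * C₆) + 1 + 1) :=
        mul_le_mul' (rpow_half_le_add_one _) (rpow_half_le_add_one _)
    _ = ENNReal.ofReal ((CU + 1) * ((1 + CU) * C₆ + 2)) := by
        have e2 : ENNReal.ofReal ((CU + 1) * ((1 + CU) * C₆ + 2)) =
            (ENNReal.ofReal CU + 1) * (ENNReal.ofReal ((1 + CU) * C₆) + 1 + 1) := by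
          rw [ENNReal.ofReal_mul (by positivity), ENNReal.ofReal_add hCU.le zero_le_one,
            ENNReal.ofReal_one, ENNReal.ofReal_add (by positivity) (by norm_num), add_assoc,
            show ENNReal.ofReal (2 : ℝ) = 1 + 1 by norm_num]
        rw [e2]


/-- PROVED bookkeeping stub `stub_acrossCutCompose` (= `TwoReplicaTransienceBound_of`). -/
theorem stub_acrossCutCompose : Goal.stub_acrossCutCompose := TwoReplicaTransienceBound_of

end Summit.AtomisticToContinuum.BoseEinsteinCondensation.Cruxes.TwoReplicaTransienceBound.AcrossCutThinning

end
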